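import Mathlib.LinearAlgebra.Matrix.NonsingularInverse
import Literature.Computability.AlgebraicComplexity.GroupAlgebraTensor
import Summits.MatrixMultiplication.MatrixMultiplication.Theorems.FarEdgeDescentTwistRigidity
import HarnessLib

/-!
# Far-edge descent — twist rigidity, restriction side: generic twisted stars are restriction-incomparable with the coherent star at every level

Support file for route `FarEdgeDescent` (aside `SubLogRate`), kernel VI-c of the lineage
`decomp-mm-lens-2` («structural dichotomy, special vs generic»); cut of record (rev 13)
`FiniteSaturation ∧ AnchoredLogConvexity → MatrixMultiplication` UNCHANGED.

Kernel VI (`FarEdgeDescentTwistRigidity`) decides the direction `⟨n,n,2L⟩^{⊠N} ⊵ 𝔖_φ^{⊠N}` (iff `φ`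
is a product permutation).  This file decides the CASHING direction for RESTRICTION:

* **Inversion lemma** (`TensorRestrictsTo.symm_of_probes`, BCS §14.2 folklore «a restriction onto a
  concise tensor of the same format is an isomorphism», in the elementary form used here): if
  `s ≥ t`, the three index formats of `s` and `t` are in bijection, and every slice of `t` in every
  slot has a PROBE entry (an index pair at which exactly that slice is `1` and all others `0`), then
  the restriction matrices are invertible and `t ≥ s`.  Proof: a vector in the left kernel of the
  (square, reindexed) matrix kills the corresponding combination of slices of `t`, which the probe
  reads off coefficientwise; `vecMul`-injective square matrices over a field are units
  (`Matrix.vecMul_injective_iff_isUnit`); the inverse matrices restrict `t` back to `s`.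
* Kronecker powers of matrix multiplication tensors have probes in all three slots
  (`matMulPow_probe₁/₂/₃`).
* **Headline** (`permStar_pow_restrictsTo_matMul_pow_iff`): for every field, `L ≥ 1`, `N ≥ 1`, every
  permutation `φ` of `Fin n × Fin n`:  `𝔖_φ^{⊠N} ≥ ⟨n,n,2L⟩^{⊠N}` (restriction) **iff** `φ` is a product
  permutation; hence (`permStar_pow_restriction_incomparable`) for every GENERIC twist the powers
  `𝔖_φ^{⊠N}` and `⟨n,n,2L⟩^{⊠N}` are RESTRICTION-INCOMPARABLE at every finite level `N ≥ 1`, while for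
  SPECIAL twists they are isomorphic.  What stays open on the cashing side is DEGENERATION with or
  without helper (`𝔖_φ^{⊠N} (⊕ helper) ⊵ ⟨n,n,2L⟩^{⊠N}`): known only for the double coset of `ᵀ`
  (Kernel II: never without helper; Kernel V: helper `⟨2⟩` suffices at `n = 2`, `N = 2`).

[cite: BurgisserClausenShokrollahi1997, §14.2, (14.19), (15.19)–(15.25); Blaser2013, Lemma 5.4]
-/

noncomputable section

set_option linter.dupNamespace false

namespace Summit.MatrixMultiplication.MatrixMultiplication.Theorems.FarEdgeDescentTwistRigidity

open Literature.Computability.AlgebraicComplexity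

/-! ## The inversion lemma -/

section Inversion

variable {K : Type*} [Field K]

/-- A square matrix over a field whose left kernel is trivial is a unit: `M⁻¹ * M = 1`.
[cite: BurgisserClausenShokrollahi1997, (14.19)] -/
theorem nonsing_inv_mul_of_vecMul_eq_zero {m : Type*} [Fintype m] [DecidableEq m]
    (M : Matrix m m K) (h : ∀ v : m → K, Matrix.vecMul v M = 0 → v = 0) : M⁻¹ * M = 1 := by
  have hinj : Function.Injective M.vecMul := by
    intro v w hvw
    have h0 : Matrix.vecMul (v - w) M = 0 := by
      rw [Matrix.sub_vecMul]
      exact sub_eq_zero.mpr hvw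
    exact sub_eq_zero.mp (h _ h0)
  exact Matrix.nonsing_inv_mul M
    ((Matrix.isUnit_iff_isUnit_det M).mp (Matrix.vecMul_injective_iff_isUnit.mp hinj))

/-- Probe calculus: a combination of slices that vanishes identically vanishes at a probe, where it
equals one coefficient. [folklore] -/
theorem coeff_eq_zero_of_probe {α : Type*} [Fintype α] [DecidableEq α] (v : α → K) (f : α → K)
    (a₀ : α) (hf : ∀ a, f a = if a = a₀ then 1 else 0) (h : ∑ a, v a * f a = 0) : v a₀ = 0 := by
  simpa [hf, Finset.sum_ite_eq', Finset.mem_univ] using h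

/-- Left-kernel transport: if `∑_{a'} v a' A a' a = 0` for all `a`, then `∑_{a'} v a' (∑_a A a' a F a) = 0`.
[folklore] -/
theorem sum_mul_sum_eq_zero {α α' : Type*} [Fintype α] [Fintype α'] (v : α' → K) (A : α' → α → K)
    (F : α → K) (hv : ∀ a, ∑ a', v a' * A a' a = 0) :
    ∑ a', v a' * ∑ a, A a' a * F a = 0 := by
  calc ∑ a', v a' * ∑ a, A a' a * F a = ∑ a', ∑ a, v a' * A a' a * F a := by
        refine Finset.sum_congr rfl fun a' _ => ?_
        rw [Finset.mul_sum]
        exact Finset.sum_congr rfl fun a _ => by ring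
    _ = ∑ a, (∑ a', v a' * A a' a) * F a := by
        rw [Finset.sum_comm]
        exact Finset.sum_congr rfl fun a _ => by rw [Finset.sum_mul]
    _ = 0 := by simp [hv]

/-- Entries of `vecMul`. [folklore] -/
theorem vecMul_apply_sum {m n : Type*} [Fintype m] (v : m → K) (M : Matrix m n K) (x : n) :
    Matrix.vecMul v M x = ∑ j, v j * M j x := rfl

variable {ι κ μ ι' κ' μ' : Type*} [Fintype ι] [Fintype κ] [Fintype μ] [Fintype ι'] [Fintype κ']
  [Fintype μ'] [DecidableEq ι] [DecidableEq κ] [DecidableEq μ] [DecidableEq ι'] [DecidableEq κ']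
  [DecidableEq μ']

/-- **Inversion lemma.**  A restriction `s ≥ t` onto a tensor `t` of the same format (index
bijections `e₁, e₂, e₃`) all of whose slices, in each of the three slots, have probe entries, is
invertible: `t ≥ s`. (BCS §14.2: concise of equal format ⇒ the restriction maps are isomorphisms.)
[cite: BurgisserClausenShokrollahi1997, §14.2] -/
theorem TensorRestrictsTo.symm_of_probes {s : ι → κ → μ → K} {t : ι' → κ' → μ' → K}
    (e₁ : ι ≃ ι') (e₂ : κ ≃ κ') (e₃ : μ ≃ μ')
    (h₁ : ∀ a₀ : ι', ∃ b c, ∀ a, t a b c = if a = a₀ then 1 else 0)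
    (h₂ : ∀ b₀ : κ', ∃ a c, ∀ b, t a b c = if b = b₀ then 1 else 0)
    (h₃ : ∀ c₀ : μ', ∃ a b, ∀ c, t a b c = if c = c₀ then 1 else 0)
    (h : TensorRestrictsTo s t) : TensorRestrictsTo t s := by
  obtain ⟨A, B, C, ht⟩ := h
  -- square reindexed matrices
  set A' : Matrix ι' ι' K := Matrix.of fun a' a'' => A a' (e₁.symm a'') with hA'
  set B' : Matrix κ' κ' K := Matrix.of fun b' b'' => B b' (e₂.symm b'') with hB'
  set C' : Matrix μ' μ' K := Matrix.of fun c' c'' => C c' (e₃.symm c'') with hC'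
  have hA'app : ∀ j x, A' j x = A j (e₁.symm x) := fun _ _ => by rw [hA']; rfl
  have hB'app : ∀ j x, B' j x = B j (e₂.symm x) := fun _ _ => by rw [hB']; rfl
  have hC'app : ∀ j x, C' j x = C j (e₃.symm x) := fun _ _ => by rw [hC']; rfl
  -- slot 1: trivial left kernel
  have kA : ∀ v : ι' → K, Matrix.vecMul v A' = 0 → v = 0 := by
    intro v hv
    have hv' : ∀ a, ∑ a', v a' * A a' a = 0 := fun a => by
      have h0 := congrFun hv (e₁ a)
      rw [vecMul_apply_sum] at h0
      simpa [hA'app] using h0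
    funext a₀
    obtain ⟨b₀, c₀, hp⟩ := h₁ a₀
    refine coeff_eq_zero_of_probe v (fun a' => t a' b₀ c₀) a₀ hp ?_
    have hF : ∀ a', t a' b₀ c₀ = ∑ a, A a' a * ∑ b, ∑ c, B b₀ b * C c₀ c * s a b c := by
      intro a'
      rw [ht]
      refine Finset.sum_congr rfl fun a _ => ?_
      rw [Finset.mul_sum]
      refine Finset.sum_congr rfl fun b _ => ?_
      rw [Finset.mul_sum]
      exact Finset.sum_congr rfl fun c _ => by ring
    simp only [hF]
    exact sum_mul_sum_eq_zero v A _ hv'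
  -- slot 2
  have kB : ∀ v : κ' → K, Matrix.vecMul v B' = 0 → v = 0 := by
    intro v hv
    have hv' : ∀ b, ∑ b', v b' * B b' b = 0 := fun b => by
      have h0 := congrFun hv (e₂ b)
      rw [vecMul_apply_sum] at h0
      simpa [hB'app] using h0
    funext b₀
    obtain ⟨a₀, c₀, hp⟩ := h₂ b₀
    refine coeff_eq_zero_of_probe v (fun b' => t a₀ b' c₀) b₀ hp ?_
    have hF : ∀ b', t a₀ b' c₀ = ∑ b, B b' b * ∑ a, ∑ c, A a₀ a * C c₀ c * s a b c := by
      intro b'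
      rw [ht, Finset.sum_comm]
      refine Finset.sum_congr rfl fun b _ => ?_
      rw [Finset.mul_sum]
      refine Finset.sum_congr rfl fun a _ => ?_
      rw [Finset.mul_sum]
      exact Finset.sum_congr rfl fun c _ => by ring
    simp only [hF]
    exact sum_mul_sum_eq_zero v B _ hv'
  -- slot 3
  have kC : ∀ v : μ' → K, Matrix.vecMul v C' = 0 → v = 0 := by
    intro v hv
    have hv' : ∀ c, ∑ c', v c' * C c' c = 0 := fun c => by
      have h0 := congrFun hv (e₃ c)
      rw [vecMul_apply_sum] at h0
      simpa [hC'app] using h0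
    funext c₀
    obtain ⟨a₀, b₀, hp⟩ := h₃ c₀
    refine coeff_eq_zero_of_probe v (fun c' => t a₀ b₀ c') c₀ hp ?_
    have hF : ∀ c', t a₀ b₀ c' = ∑ c, C c' c * ∑ b, ∑ a, A a₀ a * B b₀ b * s a b c := by
      intro c'
      rw [ht, sum_rev₃]
      refine Finset.sum_congr rfl fun c _ => ?_
      rw [Finset.mul_sum]
      refine Finset.sum_congr rfl fun b _ => ?_
      rw [Finset.mul_sum]
      exact Finset.sum_congr rfl fun a _ => by ring
    simp only [hF]
    exact sum_mul_sum_eq_zero v C _ hv'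
  have iA := nonsing_inv_mul_of_vecMul_eq_zero A' kA
  have iB := nonsing_inv_mul_of_vecMul_eq_zero B' kB
  have iC := nonsing_inv_mul_of_vecMul_eq_zero C' kC
  -- the Kronecker deltas
  have cA : ∀ a a₁, ∑ a', A'⁻¹ (e₁ a) a' * A a' a₁ = if a = a₁ then 1 else 0 := by
    intro a a₁
    have h0 := congrFun (congrFun iA (e₁ a)) (e₁ a₁)
    rw [Matrix.mul_apply, Matrix.one_apply] at h0
    simpa [hA'app] using h0
  have cB : ∀ b b₁, ∑ b', B'⁻¹ (e₂ b) b' * B b' b₁ = if b = b₁ then 1 else 0 := by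
    intro b b₁
    have h0 := congrFun (congrFun iB (e₂ b)) (e₂ b₁)
    rw [Matrix.mul_apply, Matrix.one_apply] at h0
    simpa [hB'app] using h0
  have cC : ∀ c c₁, ∑ c', C'⁻¹ (e₃ c) c' * C c' c₁ = if c = c₁ then 1 else 0 := by
    intro c c₁
    have h0 := congrFun (congrFun iC (e₃ c)) (e₃ c₁)
    rw [Matrix.mul_apply, Matrix.one_apply] at h0
    simpa [hC'app] using h0
  refine ⟨fun a a' => A'⁻¹ (e₁ a) a', fun b b' => B'⁻¹ (e₂ b) b', fun c c' => C'⁻¹ (e₃ c) c',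
    fun a b c => ?_⟩
  -- expand `t` through `s` and regroup (as in `TensorRestrictsTo.trans`)
  have step : ∑ a', ∑ b', ∑ c', A'⁻¹ (e₁ a) a' * B'⁻¹ (e₂ b) b' * C'⁻¹ (e₃ c) c' * t a' b' c' =
      ∑ a₁, ∑ b₁, ∑ c₁, (∑ a', A'⁻¹ (e₁ a) a' * A a' a₁) * (∑ b', B'⁻¹ (e₂ b) b' * B b' b₁) *
        (∑ c', C'⁻¹ (e₃ c) c' * C c' c₁) * s a₁ b₁ c₁ := by
    simp only [ht, Finset.mul_sum, Finset.sum_mul]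
    rw [sum_comm₃]
    refine Finset.sum_congr rfl fun a₁ _ => Finset.sum_congr rfl fun b₁ _ =>
      Finset.sum_congr rfl fun c₁ _ => ?_
    rw [sum_rev₃]
    refine Finset.sum_congr rfl fun c' _ => Finset.sum_congr rfl fun b' _ =>
      Finset.sum_congr rfl fun a' _ => ?_
    ring
  rw [step]
  simp only [cA, cB, cC]
  rw [Finset.sum_eq_single a, Finset.sum_eq_single b, Finset.sum_eq_single c]
  · simp
  · intro c₁ _ hc; simp [Ne.symm hc]
  · simp
  · intro b₁ _ hb; simp [Ne.symm hb]
  · simp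
  · intro a₁ _ ha; simp [Ne.symm ha]
  · simp

end Inversion

/-! ## Probes of Kronecker powers of matrix multiplication tensors -/

section Probes

variable {K : Type*} [Field K] {k m p N : ℕ}

/-- Entries of `⟨k,m,p⟩` (definitional unfolding). [cite: Blaser2013, §5] -/
theorem matMulTensor_def (a : Fin k × Fin p) (b : Fin k × Fin m) (c : Fin m × Fin p) :
    matMulTensor K k m p a b c = if a.1 = b.1 ∧ b.2 = c.1 ∧ a.2 = c.2 then 1 else 0 := rfl

/-- Slot-1 probes of `⟨k,m,p⟩^{⊠N}` (`m ≥ 1`): the slice of `a₀ = (κ,ν)` is read at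
`b = (κ, 0)`, `c = (0, ν)`. [folklore] -/
theorem matMulPow_probe₁ (hm : 1 ≤ m) (a₀ : Fin N → Fin k × Fin p) :
    ∃ b c, ∀ a, kroneckerPow (matMulTensor K k m p) N a b c = if a = a₀ then 1 else 0 := by
  refine ⟨fun i => ((a₀ i).1, ⟨0, by omega⟩), fun i => (⟨0, by omega⟩, (a₀ i).2), fun a => ?_⟩
  rw [kroneckerPow_apply]
  have e : ∀ i, matMulTensor K k m p (a i) ((a₀ i).1, ⟨0, by omega⟩) (⟨0, by omega⟩, (a₀ i).2) =
      if a i = a₀ i then 1 else 0 := fun i => by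
    simp only [matMulTensor_def, true_and, Prod.ext_iff]
  simp only [e, Finset.prod_boole, Finset.mem_univ, true_implies, funext_iff]

/-- Slot-2 probes of `⟨k,m,p⟩^{⊠N}` (`p ≥ 1`). [folklore] -/
theorem matMulPow_probe₂ (hp : 1 ≤ p) (b₀ : Fin N → Fin k × Fin m) :
    ∃ a c, ∀ b, kroneckerPow (matMulTensor K k m p) N a b c = if b = b₀ then 1 else 0 := by
  refine ⟨fun i => ((b₀ i).1, ⟨0, by omega⟩), fun i => ((b₀ i).2, ⟨0, by omega⟩), fun b => ?_⟩
  rw [kroneckerPow_apply]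
  have e : ∀ i, matMulTensor K k m p ((b₀ i).1, ⟨0, by omega⟩) (b i) ((b₀ i).2, ⟨0, by omega⟩) =
      if b i = b₀ i then 1 else 0 := fun i => by
    by_cases hb : b i = b₀ i
    · rw [matMulTensor_def, if_pos hb, if_pos ⟨by rw [hb], by rw [hb], rfl⟩]
    · rw [matMulTensor_def, if_neg hb, if_neg]
      rintro ⟨h1, h2, -⟩
      exact hb (Prod.ext h1.symm h2)
  simp only [e, Finset.prod_boole, Finset.mem_univ, true_implies, funext_iff]

/-- Slot-3 probes of `⟨k,m,p⟩^{⊠N}` (`k ≥ 1`). [folklore] -/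
theorem matMulPow_probe₃ (hk : 1 ≤ k) (c₀ : Fin N → Fin m × Fin p) :
    ∃ a b, ∀ c, kroneckerPow (matMulTensor K k m p) N a b c = if c = c₀ then 1 else 0 := by
  refine ⟨fun i => (⟨0, by omega⟩, (c₀ i).2), fun i => (⟨0, by omega⟩, (c₀ i).1), fun c => ?_⟩
  rw [kroneckerPow_apply]
  have e : ∀ i, matMulTensor K k m p (⟨0, by omega⟩, (c₀ i).2) (⟨0, by omega⟩, (c₀ i).1) (c i) =
      if c i = c₀ i then 1 else 0 := fun i => by
    by_cases hc : c i = c₀ i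
    · rw [matMulTensor_def, if_pos hc, if_pos ⟨rfl, by rw [hc], by rw [hc]⟩]
    · rw [matMulTensor_def, if_neg hc, if_neg]
      rintro ⟨-, h1, h2⟩
      exact hc (Prod.ext h1.symm h2.symm)
  simp only [e, Finset.prod_boole, Finset.mem_univ, true_implies, funext_iff]

end Probes

/-! ## The restriction dichotomy -/

section Main

variable {K : Type*} [Field K] {n L N : ℕ}

/-- The format bijection between the leaf slots of `𝔖_φ` and of `⟨n,n,L+L⟩`. [folklore] -/
def leafFmt (n L : ℕ) : (Fin n × Fin L) ⊕ (Fin n × Fin L) ≃ Fin n × Fin (L + L) :=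
  (Equiv.prodSumDistrib (Fin n) (Fin L) (Fin L)).symm.trans
    ((Equiv.refl (Fin n)).prodCongr finSumFinEquiv)

/-- **Restriction cashing is invertible**: `𝔖_φ^{⊠N} ≥ ⟨n,n,L+L⟩^{⊠N}` forces
`⟨n,n,L+L⟩^{⊠N} ≥ 𝔖_φ^{⊠N}` (`n ≥ 1`, `L ≥ 1`; inversion lemma + probes). [cite: BurgisserClausenShokrollahi1997, §14.2] -/
theorem matMul_pow_restrictsTo_of_permStar_pow_restrictsTo (hn : 1 ≤ n) (hL : 1 ≤ L)
    {φ : Equiv.Perm (Fin n × Fin n)}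
    (h : TensorRestrictsTo (kroneckerPow (permStar K n L φ) N)
      (kroneckerPow (matMulTensor K n n (L + L)) N)) :
    TensorRestrictsTo (kroneckerPow (matMulTensor K n n (L + L)) N)
      (kroneckerPow (permStar K n L φ) N) := by
  classical
  exact TensorRestrictsTo.symm_of_probes (Equiv.piCongrRight fun _ => leafFmt n L) (Equiv.refl _)
    (Equiv.piCongrRight fun _ => leafFmt n L) (matMulPow_probe₁ hn) (matMulPow_probe₂ (by omega))
    (matMulPow_probe₃ hn) h

/-- **THE RESTRICTION DICHOTOMY.**  For every field, `L ≥ 1`, `N ≥ 1`, every permutation `φ` of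
`Fin n × Fin n`: `𝔖_φ^{⊠N} ≥ ⟨n,n,L+L⟩^{⊠N}` (restriction) iff `φ` is a product permutation.
[cite: BurgisserClausenShokrollahi1997, §14.2, (15.19)] -/
theorem permStar_pow_restrictsTo_matMul_pow_iff (φ : Equiv.Perm (Fin n × Fin n)) (hL : 1 ≤ L)
    (hN : 1 ≤ N) :
    TensorRestrictsTo (kroneckerPow (permStar K n L φ) N)
        (kroneckerPow (matMulTensor K n n (L + L)) N) ↔ IsProdPerm φ := by
  refine ⟨fun h => by_contra fun hφ => ?_, fun hφ => (permStar_restrictsTo_matMul hφ).kroneckerPow N⟩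
  have hn : 2 ≤ n := two_le_of_not_isProdPerm hφ
  exact matMul_pow_not_algDegeneratesTo_permStar_pow hφ hL hN
    (matMul_pow_restrictsTo_of_permStar_pow_restrictsTo (by omega) hL h).algDegeneratesTo

/-- The same for the other direction of restriction (a restatement of Kernel VI for restriction).
[cite: BurgisserClausenShokrollahi1997, (15.19), (15.20)] -/
theorem matMul_pow_restrictsTo_permStar_pow_iff (φ : Equiv.Perm (Fin n × Fin n)) (hL : 1 ≤ L)
    (hN : 1 ≤ N) :
    TensorRestrictsTo (kroneckerPow (matMulTensor K n n (L + L)) N)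
        (kroneckerPow (permStar K n L φ) N) ↔ IsProdPerm φ :=
  ⟨fun h => (matMul_pow_algDegeneratesTo_permStar_pow_iff φ hL hN).mp h.algDegeneratesTo,
    fun hφ => (matMul_restrictsTo_permStar hφ).kroneckerPow N⟩

/-- **GENERIC twists are restriction-incomparable with the coherent star at every finite level**:
for `φ` not a product permutation, `L ≥ 1`, `N ≥ 1`, neither of `𝔖_φ^{⊠N}`, `⟨n,n,L+L⟩^{⊠N}`
restricts to the other. [cite: BurgisserClausenShokrollahi1997, §14.2, (15.19)] -/
theorem permStar_pow_restriction_incomparable {φ : Equiv.Perm (Fin n × Fin n)}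
    (hφ : ¬ IsProdPerm φ) (hL : 1 ≤ L) (hN : 1 ≤ N) :
    ¬ TensorRestrictsTo (kroneckerPow (permStar K n L φ) N)
        (kroneckerPow (matMulTensor K n n (L + L)) N) ∧
      ¬ TensorRestrictsTo (kroneckerPow (matMulTensor K n n (L + L)) N)
        (kroneckerPow (permStar K n L φ) N) :=
  ⟨fun h => hφ ((permStar_pow_restrictsTo_matMul_pow_iff φ hL hN).mp h),
    fun h => hφ ((matMul_pow_restrictsTo_permStar_pow_iff φ hL hN).mp h)⟩

/-- Single copy, far edge included: `𝔖_φ ≥ ⟨n,n,L+L⟩` iff `φ` is a product permutation (`L ≥ 1`).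
[cite: BurgisserClausenShokrollahi1997, §14.2] -/
theorem permStar_restrictsTo_matMul_iff (φ : Equiv.Perm (Fin n × Fin n)) (hL : 1 ≤ L) :
    TensorRestrictsTo (permStar K n L φ) (matMulTensor K n n (L + L)) ↔ IsProdPerm φ := by
  refine ⟨fun h => (permStar_pow_restrictsTo_matMul_pow_iff φ hL le_rfl).mp (h.kroneckerPow 1),
    fun hφ => permStar_restrictsTo_matMul hφ⟩

end Main

end Summit.MatrixMultiplication.MatrixMultiplication.Theorems.FarEdgeDescentTwistRigidity

end
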